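import Summits.AtomisticToContinuum.Crystallization.Theorems.FrustratedLawDichotomyDRowsA15Sound
import Summits.AtomisticToContinuum.Crystallization.Theorems.FrustratedLawDichotomyDRowsBccTemplate

/-!
# DROWS-SOUND for the A15 chunk, piece (s1) I: the A15 template, its separation, and the window/far bookkeeping

decomp-a2c hand-2 g46 — structural share for `AperiodicFrustratedLawGap` (stmt-27623), class-D rows (critic r1757 (C)(b) «DROWS-SOUND»;
census K certificate (234) `…DRowsA15`, read over `ℝ` by `…DRowsA15Sound.drows_A15_sound`).  The A15 (Cr₃Si, Frank–Kasper) template in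
census's integer frame: translations `4ℤ³`, basis `a15Basis` = `(0,0,0),(2,2,2)` (class X, icosahedral sites) and `(1,0,2),(3,0,2),(2,1,0),
(2,3,0),(0,2,1),(0,2,3)` (class Y, chain sites); nearest-neighbour squared frame length `4`, so the template at NN distance `s` is the frame scaled
by `s/2` (`scaledIntPoint (s/2)`), ROOTED at a frame point `r` (`a15Template r s` = the frame translated by `−r`, then scaled).

Proved here (symbolic): the basis membership test `inFrame`, its `mod 4` reading; ★ `four_le_nsq_of_frame` — two distinct frame points are at
squared frame distance `≥ 4` (reduction to the finite check `small_diff_check` over `{−1,0,1}³ × basis²`, `decide`); `a15Template_separated`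
(the template at NN distance `s` is `s`-separated); the frame box `[-23,23]³` of the root-centred vectors (`a15Box r`), the window `a15Win r i`
(census's test `sNum (i+1)²·D < 100·4·sDen²`), `nsq_lt_of_inside_A15` (`⇒ D < 575`) and `far_of_not_mem_a15Win`.  The kernel counting facts
(COVER/FIBRES per root class) and the composition with `…DRowsAssembly` / `…DRowsRegroup` / `drows_A15_sound` follow in the sequel files.
Reuses `toVec`/`nsq` and their lemmas from `…DRowsBccTemplate`.
-/

namespace Summit.AtomisticToContinuum.Crystallization.Theorems.FrustratedLawDichotomyDRowsA15Template

open MeasureTheory Metric Set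
open scoped BigOperators
open Literature.Barriers.AtomisticToContinuum (scaledIntPoint scaledIntPoint_apply norm_scaledIntPoint_sq scaledIntPoint_injective
  scaledIntPoint_zero)
open Summit.AtomisticToContinuum.Crystallization.Theorems.ChargedEnergyGapNegative (E3)
open Summit.AtomisticToContinuum.Crystallization.Theorems.FrustratedLawDichotomyDRowsA15 (sNum sDen xnum XD)
open Summit.AtomisticToContinuum.Crystallization.Theorems.FrustratedLawDichotomyDRowsBccTemplate
  (toVec nsq toVec_zero toVec_one toVec_two toVec_injective toVec_triple toVec_zero' norm_sq_toVec nsq_nonneg scaledIntPoint_sub)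

/-! ## §1 The frame -/

/-- the A15 basis in the integer frame (cell `4ℤ³`): two class-X sites, six class-Y (chain) sites. -/
def a15Basis : List (ℤ × ℤ × ℤ) := [(0, 0, 0), (2, 2, 2), (1, 0, 2), (3, 0, 2), (2, 1, 0), (2, 3, 0), (0, 2, 1), (0, 2, 3)]

/-- frame membership: `m ∈ 4ℤ³ + a15Basis` (a Boolean test, kernel-friendly). -/
def inFrame (m : ℤ × ℤ × ℤ) : Bool :=
  a15Basis.any fun b => (m.1 - b.1) % 4 == 0 && (m.2.1 - b.2.1) % 4 == 0 && (m.2.2 - b.2.2) % 4 == 0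

/-- **The A15 template at nearest-neighbour distance `s`, rooted at the frame point `r`**: `{(s/2)·(m − r) : m ∈ frame}`. -/
def a15Template (r : ℤ × ℤ × ℤ) (s : ℝ) : Set E3 :=
  {x | ∃ v : Fin 3 → ℤ, inFrame (v 0 + r.1, v 1 + r.2.1, v 2 + r.2.2) = true ∧ x = scaledIntPoint (s / 2) v}

/-- the root-centred frame vectors `m − r` in the box `[-23, 23]³`, `m ∈ frame`, `m ≠ r` (every such vector of squared length `< 575` is in it). -/
noncomputable def a15Box (r : ℤ × ℤ × ℤ) : Finset (ℤ × ℤ × ℤ) :=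
  ((Finset.Icc (-23 : ℤ) 23) ×ˢ ((Finset.Icc (-23 : ℤ) 23) ×ˢ (Finset.Icc (-23 : ℤ) 23))).filter
    fun v => inFrame (v.1 + r.1, v.2.1 + r.2.1, v.2.2 + r.2.2) = true ∧ v ≠ 0

/-- the root-centred frame vectors inside the cut of leaf `i` (census's test `sNum (i+1)²·D < 100·4·sDen²` verbatim). -/
noncomputable def a15Win (r : ℤ × ℤ × ℤ) (i : ℕ) : Finset (ℤ × ℤ × ℤ) :=
  (a15Box r).filter fun v => sNum (i + 1) * sNum (i + 1) * nsq v < 100 * (4 * sDen * sDen)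

/-- the membership test read in `mod 4` arithmetic. -/
theorem inFrame_iff (m : ℤ × ℤ × ℤ) :
    inFrame m = true ↔ ∃ b ∈ a15Basis, (m.1 - b.1) % 4 = 0 ∧ (m.2.1 - b.2.1) % 4 = 0 ∧ (m.2.2 - b.2.2) % 4 = 0 := by
  simp [inFrame, List.any_eq_true, Bool.and_eq_true, beq_iff_eq, and_assoc]

/-! ## §2 Separation: distinct frame points are at squared frame distance ≥ 4 -/

/-- the finite check: no nonzero vector of `{−1,0,1}³` is congruent `mod 4` to a difference of two basis points. -/
theorem small_diff_check : ∀ b ∈ a15Basis, ∀ b' ∈ a15Basis, ∀ u1 ∈ [(-1 : ℤ), 0, 1], ∀ u2 ∈ [(-1 : ℤ), 0, 1], ∀ u3 ∈ [(-1 : ℤ), 0, 1],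
    (u1 - (b.1 - b'.1)) % 4 = 0 → (u2 - (b.2.1 - b'.2.1)) % 4 = 0 → (u3 - (b.2.2 - b'.2.2)) % 4 = 0 → u1 = 0 ∧ u2 = 0 ∧ u3 = 0 := by
  decide

/-- an integer of square `≤ 3` lies in `{−1, 0, 1}`. -/
theorem mem_small_of_sq_le {a : ℤ} (h : a * a ≤ 3) : a ∈ [(-1 : ℤ), 0, 1] := by
  have h1 : -1 ≤ a := by nlinarith
  have h2 : a ≤ 1 := by nlinarith
  simp only [List.mem_cons, List.mem_nil_iff, or_false]
  omega

/-- ★ two distinct points of the A15 frame are at squared frame distance at least `4`. -/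
theorem four_le_nsq_of_frame {m m' : ℤ × ℤ × ℤ} (hm : inFrame m = true) (hm' : inFrame m' = true) (hne : m ≠ m') :
    4 ≤ nsq (m.1 - m'.1, m.2.1 - m'.2.1, m.2.2 - m'.2.2) := by
  by_contra hlt
  push Not at hlt
  obtain ⟨b, hb, hb1, hb2, hb3⟩ := (inFrame_iff m).mp hm
  obtain ⟨b', hb', hb1', hb2', hb3'⟩ := (inFrame_iff m').mp hm'
  have hsum : (m.1 - m'.1) * (m.1 - m'.1) + (m.2.1 - m'.2.1) * (m.2.1 - m'.2.1) + (m.2.2 - m'.2.2) * (m.2.2 - m'.2.2) ≤ 3 := by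
    unfold nsq at hlt; simpa using Int.lt_add_one_iff.mp hlt
  have hs1 := mem_small_of_sq_le (a := m.1 - m'.1)
    (by nlinarith [mul_self_nonneg (m.2.1 - m'.2.1), mul_self_nonneg (m.2.2 - m'.2.2)])
  have hs2 := mem_small_of_sq_le (a := m.2.1 - m'.2.1)
    (by nlinarith [mul_self_nonneg (m.1 - m'.1), mul_self_nonneg (m.2.2 - m'.2.2)])
  have hs3 := mem_small_of_sq_le (a := m.2.2 - m'.2.2)
    (by nlinarith [mul_self_nonneg (m.1 - m'.1), mul_self_nonneg (m.2.1 - m'.2.1)])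
  have h := small_diff_check b hb b' hb' _ hs1 _ hs2 _ hs3 (by omega) (by omega) (by omega)
  apply hne
  exact Prod.ext (by omega) (Prod.ext (by omega) (by omega))

/-- ★ the A15 template at NN distance `s > 0` (any root) is `s`-separated. -/
theorem a15Template_separated (r : ℤ × ℤ × ℤ) {s : ℝ} (hs : 0 < s) :
    ∀ p ∈ a15Template r s, ∀ p' ∈ a15Template r s, p ≠ p' → s ≤ dist p p' := by
  rintro p ⟨v, hv, rfl⟩ p' ⟨w, hw, rfl⟩ hne
  rw [dist_eq_norm, scaledIntPoint_sub]
  have hne' : (v 0 + r.1, v 1 + r.2.1, v 2 + r.2.2) ≠ (w 0 + r.1, w 1 + r.2.1, w 2 + r.2.2) := by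
    intro h
    simp only [Prod.mk.injEq] at h
    apply hne
    have : v = w := by
      funext j; fin_cases j
      · simpa using h.1
      · simpa using h.2.1
      · simpa using h.2.2
    rw [this]
  have h4 := four_le_nsq_of_frame hv hw hne'
  have h4' : (4 : ℤ) ≤ (v 0 - w 0) * (v 0 - w 0) + (v 1 - w 1) * (v 1 - w 1) + (v 2 - w 2) * (v 2 - w 2) := by
    unfold nsq at h4; simpa using h4
  have hsq : s ^ 2 ≤ ‖scaledIntPoint (s / 2) (v - w)‖ ^ 2 := by
    rw [norm_scaledIntPoint_sq, Fin.sum_univ_three, div_pow]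
    simp only [Pi.sub_apply, Int.cast_sub]
    have : (4 : ℝ) ≤ ((v 0 : ℝ) - w 0) ^ 2 + ((v 1 : ℝ) - w 1) ^ 2 + ((v 2 : ℝ) - w 2) ^ 2 := by
      have := (Int.cast_le (R := ℝ)).mpr h4'
      push_cast at this; nlinarith
    nlinarith [sq_nonneg s]
  exact (pow_le_pow_iff_left₀ hs.le (norm_nonneg _) two_ne_zero).mp hsq

/-- the root belongs to its template when it is a frame point. -/
theorem zero_mem_a15Template {r : ℤ × ℤ × ℤ} (hr : inFrame r = true) (s : ℝ) : (0 : E3) ∈ a15Template r s :=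
  ⟨0, by simpa using hr, (scaledIntPoint_zero _).symm⟩

/-! ## §3 Arithmetic of the A15 scale window -/

/-- the common denominator of the A15 scale is positive (file-local). -/
private theorem sDen_pos : 0 < sDen := by unfold sDen XD; decide

/-- `sDen = 1.28·10⁹` (file-local: the printed statement coincides with the bcc twin's). -/
private theorem sDen_eq_A15 : sDen = 1280000000 := by unfold sDen XD; norm_num

/-- the upper end of every A15 leaf is at least `sNum 1 = 88753·12044`. -/
theorem sNum_succ_ge_A15 (i : ℕ) : 1068941132 ≤ sNum (i + 1) := by unfold sNum xnum; push_cast; omega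

/-- a shell inside the cut of any A15 leaf has squared frame length `< 575`. -/
theorem nsq_lt_of_inside_A15 {i : ℕ} {D : ℤ} (hD : sNum (i + 1) * sNum (i + 1) * D < 100 * (4 * sDen * sDen)) : D < 575 := by
  by_contra hge
  push Not at hge
  have h1 := sNum_succ_ge_A15 i
  have h0 : (0 : ℤ) ≤ sNum (i + 1) := by linarith
  have h2 : (1068941132 : ℤ) * 1068941132 ≤ sNum (i + 1) * sNum (i + 1) := mul_le_mul h1 h1 (by norm_num) h0
  have h3 : sNum (i + 1) * sNum (i + 1) * 575 ≤ sNum (i + 1) * sNum (i + 1) * D := mul_le_mul_of_nonneg_left hge (mul_nonneg h0 h0)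
  rw [sDen_eq_A15] at hD
  linarith

/-- a root-centred frame vector NOT inside the cut satisfies `100·4·sDen² ≤ sNum(i+1)²·nsq v` (failed test inside the box, or a coordinate `≥ 24`). -/
theorem far_of_not_mem_a15Win {r : ℤ × ℤ × ℤ} {i : ℕ} {v : ℤ × ℤ × ℤ} (hfr : inFrame (v.1 + r.1, v.2.1 + r.2.1, v.2.2 + r.2.2) = true)
    (hv0 : v ≠ 0) (hw : v ∉ a15Win r i) : 100 * (4 * sDen * sDen) ≤ sNum (i + 1) * sNum (i + 1) * nsq v := by
  by_cases hbox : v ∈ a15Box r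
  · by_contra hlt
    push Not at hlt
    exact hw (Finset.mem_filter.mpr ⟨hbox, hlt⟩)
  · have hnot : ¬(v.1 ∈ Finset.Icc (-23 : ℤ) 23 ∧ v.2.1 ∈ Finset.Icc (-23 : ℤ) 23 ∧ v.2.2 ∈ Finset.Icc (-23 : ℤ) 23) := by
      intro h
      exact hbox (Finset.mem_filter.mpr ⟨Finset.mem_product.mpr ⟨h.1, Finset.mem_product.mpr ⟨h.2.1, h.2.2⟩⟩, hfr, hv0⟩)
    simp only [Finset.mem_Icc, not_and_or, not_le] at hnot
    have h576 : 576 ≤ nsq v := by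
      unfold nsq
      rcases hnot with (h | h) | (h | h) | (h | h) <;>
        nlinarith [mul_self_nonneg v.1, mul_self_nonneg v.2.1, mul_self_nonneg v.2.2]
    have h1 := sNum_succ_ge_A15 i
    have h0 : (0 : ℤ) ≤ sNum (i + 1) := by linarith
    have h2 : (1068941132 : ℤ) * 1068941132 ≤ sNum (i + 1) * sNum (i + 1) := mul_le_mul h1 h1 (by norm_num) h0
    have h3 : sNum (i + 1) * sNum (i + 1) * 576 ≤ sNum (i + 1) * sNum (i + 1) * nsq v :=
      mul_le_mul_of_nonneg_left h576 (mul_nonneg h0 h0)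
    rw [sDen_eq_A15]
    linarith

end Summit.AtomisticToContinuum.Crystallization.Theorems.FrustratedLawDichotomyDRowsA15Template
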